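import Summits.MatrixMultiplication.MatrixMultiplication.Theorems.FarEdgeDescentTreeCapLightCharts1
import Summits.MatrixMultiplication.MatrixMultiplication.Theorems.FarEdgeDescentTreeCapLightCharts2
import Summits.MatrixMultiplication.MatrixMultiplication.Theorems.FarEdgeDescentTreeCapBridge


/-!
# Far-edge descent, kernel XLI-H — the light-base tree cap at `β = 3/2` assembled: vertex families on the whole light window, the cap for every admissible tree, and the bridge to all schedules of the floor dial (model level)

This file assembles kernels XLI-C (heavy box), XLI-E (vertex reduction under an envelope), XLI-F
(light model, envelope `w ≤ 2 − 3λ`, cap given the vertex families) and the generated cell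
certificates XLI-G1…G10:
* `vertexL_P1`, `vertexL_C`: the P1 family and the Corner family for `capU` hold on the whole light
  window `λ, λ' ∈ (0, 2/3]`, `x ∈ [0,1]` (heavy box from `vertex_three_halves`; strips and kink wedges
  from the chart theorems `SA_P1 … W2m_P1`, `SA_C, W1_C, W2_C`; the corner family above the diagonal
  by the symmetry `(λ, λ', x) ↔ (λ', λ, 1−x)`).
* `tree_cap_light`: along EVERY `AdmL (3/2) (1/7)` product tree — all bases `b ≥ 0`, every product node
  passing the depth-2 floor — `y(T) ≤ 100R/ℓ_min^{κ_S}·Φ(T)·size(T)^{κ_S}`, and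
  `tree_cap_light_uniform`: `y(T) ≤ 58·R/ℓ_min^{κ_S}·size(T)^{κ_S}`, `κ_S = log₂(4/3)`.
* `toPTree_admL`, `sched_cap_three_halves_all`: every `Sched.Admissible a (3/2)` schedule of the floor
  dial (kernel XL-D; ANY bases `b ≥ 0`, any `a ≥ 2`, base profile `y₀(b) ≤ R/(b+β)`) has
  `Sched.dev (3/2) y₀ s ≤ 58·R/(log (3/2))^{κ_S} · (Sched.logSize (3/2) s)^{κ_S}` — the typed TREES
  conjecture of `FarEdgeDescentFloorDial` at `β = 3/2` with NO heavy-base restriction (ASKS (iii) of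
  critique g20; kernel XLI-D needed `HeavyBases`).
HONEST FRAMING: MODEL level (the dial's exact product clauses on real-labelled trees); nothing about
tensors, `ω(1,k,1)` or `AnchoredLogConvexity`; `β = 3/2` only (for `β ≥ 7/4` the depth-2 floor is
vacuous on far-edge towers, memo NODE-g61 §3); no `sorry`, no axioms, no new definitions.
References: kernels XL-D, XLI-A…G; Schönhage 1981 [Schonhage1981]; Coppersmith–Winograd 1982
[CoppersmithWinograd1982].
-/


noncomputable section

set_option linter.dupNamespace false

namespace Summit.MatrixMultiplication.MatrixMultiplication.Theorems.FarEdgeDescentTreeCapLightVertex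

open Summit.MatrixMultiplication.MatrixMultiplication.Theorems.FarEdgeDescentChainCapSteps
open Summit.MatrixMultiplication.MatrixMultiplication.Theorems.FarEdgeDescentTreeCapTools
open Summit.MatrixMultiplication.MatrixMultiplication.Theorems.FarEdgeDescentTreeCapEnvTools
open Summit.MatrixMultiplication.MatrixMultiplication.Theorems.FarEdgeDescentTreeCapThreeHalves
open Summit.MatrixMultiplication.MatrixMultiplication.Theorems.FarEdgeDescentTreeCap
open Summit.MatrixMultiplication.MatrixMultiplication.Theorems.FarEdgeDescentTreeCap.PTree
open Summit.MatrixMultiplication.MatrixMultiplication.Theorems.FarEdgeDescentTreeCapLight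
open Summit.MatrixMultiplication.MatrixMultiplication.Theorems.FarEdgeDescentTreeCapLight.PTree
open Summit.MatrixMultiplication.MatrixMultiplication.Theorems.FarEdgeDescentTreeCapBridge
open Summit.MatrixMultiplication.MatrixMultiplication.Theorems.FarEdgeDescentFloorDial
open Summit.MatrixMultiplication.MatrixMultiplication.Theorems.FarEdgeDescentTreeCapLightCharts1
open Summit.MatrixMultiplication.MatrixMultiplication.Theorems.FarEdgeDescentTreeCapLightCharts2

/-! ## The vertex families on the whole light window -/

/-- **The P1 family** for the envelope `capU` at `β = 3/2`, `ε = 1/100`, `V_min = 1/7`, on the whole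
light window. -/
theorem vertexL_P1 : ∀ lA lB x : ℝ, 0 < lA → (3 / 2 : ℝ) * lA ≤ 1 → 0 < lB → (3 / 2 : ℝ) * lB ≤ 1 →
    0 ≤ x → x ≤ 1 →
    0 ≤ (1 + 1 / 100 - 1 / 7) * (lA + lB - (2 * (3 / 2 : ℝ) - 1) * lA * lB) - (1 + 1 / 100) * lA * lB →
    (1 + 1 / 100 - 1 / 7) * (lA + lB - (2 * (3 / 2 : ℝ) - 1) * lA * lB) - (1 + 1 / 100) * lA * lB <
        (1 - 3 / 2 * lB) * capU lA + (1 - 3 / 2 * lA) * capU lB →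
    (1 - 3 / 2 * lA) * (1 - (3 / 2 - 1) * lB) * capU lA * x ^ (Real.log (4 / 3) / Real.log 2) +
          (1 - (3 / 2 - 1) * lA) * ((1 + 1 / 100 - 1 / 7) * (lA + lB - (2 * (3 / 2 : ℝ) - 1) * lA * lB) - (1 + 1 / 100) * lA * lB - (1 - 3 / 2 * lB) * capU lA) *
            (1 - x) ^ (Real.log (4 / 3) / Real.log 2) ≤
        (1 - 3 / 2 * lA) * ((1 + 1 / 100 - 1 / 7) * (lA + lB - (2 * (3 / 2 : ℝ) - 1) * lA * lB)) := by
  intro lA lB x hlA0 hlA1 hlB0 hlB1 hx0 hx1 _hcap0 hinf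
  have hA23 : lA ≤ 2 / 3 := by linarith
  have hB23 : lB ≤ 2 / 3 := by linarith
  rcases le_or_gt lA (1 / 2) with hA | hA
  · rcases le_or_gt lB (1 / 2) with hB | hB
    · -- heavy box: kernel XLI-C
      rw [capU_eq_left (show 27 / 7 * lA ≤ 2 by linarith),
        capU_eq_left (show 27 / 7 * lB ≤ 2 by linarith)] at *
      have hv := vertex_three_halves lA lB x hlA0 (by linarith) hlB0 (by linarith) hx0 hx1
      linarith
    · rcases le_or_gt lB (14 / 27) with hB2 | hB2
      · exact SB_P1 hB.le hB2 hlA0.le hA hx0 hx1 hinf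
      · rcases le_or_gt lB (14 / 27 + lA / 7) with hB3 | hB3
        · obtain ⟨T, hT0, hT1, rfl⟩ : ∃ T : ℝ, 0 ≤ T ∧ T ≤ 1 ∧ lB = 14 / 27 + T * lA / 7 := by
            refine ⟨(lB - 14 / 27) * 7 / lA, div_nonneg (by linarith) hlA0.le, ?_, ?_⟩
            · rw [div_le_one hlA0]; linarith
            · field_simp; ring
          exact W1m_P1 hT0 hT1 hlA0.le hA hx0 hx1 hinf
        · obtain ⟨T, hT0, hT1, rfl⟩ : ∃ T : ℝ, 0 ≤ T ∧ T ≤ 1 ∧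
              lB = 14 / 27 + lA / 8 + T * (4 / 27 - lA / 8) := by
            have hd : 0 < 4 / 27 - lA / 8 := by linarith
            refine ⟨(lB - 14 / 27 - lA / 8) / (4 / 27 - lA / 8), div_nonneg (by linarith) hd.le, ?_, ?_⟩
            · rw [div_le_one hd]; linarith
            · rw [div_mul_cancel₀ _ hd.ne']; ring
          exact W2m_P1 hT0 hT1 hlA0.le hA hx0 hx1 hinf
  · rcases le_or_gt lA (14 / 27) with hA2 | hA2
    · exact SA_P1 hA.le hA2 hlB0.le hB23 hx0 hx1 hinf
    · rcases le_or_gt lA (14 / 27 + lB / 7) with hA3 | hA3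
      · obtain ⟨T, hT0, hT1, rfl⟩ : ∃ T : ℝ, 0 ≤ T ∧ T ≤ 1 ∧ lA = 14 / 27 + T * lB / 7 := by
          refine ⟨(lA - 14 / 27) * 7 / lB, div_nonneg (by linarith) hlB0.le, ?_, ?_⟩
          · rw [div_le_one hlB0]; linarith
          · field_simp; ring
        exact W1_P1 hT0 hT1 hlB0.le hB23 hx0 hx1 hinf
      · obtain ⟨T, hT0, hT1, rfl⟩ : ∃ T : ℝ, 0 ≤ T ∧ T ≤ 1 ∧
            lA = 14 / 27 + lB / 8 + T * (4 / 27 - lB / 8) := by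
          have hd : 0 < 4 / 27 - lB / 8 := by linarith
          refine ⟨(lA - 14 / 27 - lB / 8) / (4 / 27 - lB / 8), div_nonneg (by linarith) hd.le, ?_, ?_⟩
          · rw [div_le_one hd]; linarith
          · rw [div_mul_cancel₀ _ hd.ne']; ring
        exact W2_P1 hT0 hT1 hlB0.le hB23 hx0 hx1 hinf

/-- The corner family below the diagonal `λ' ≤ λ`. -/
theorem vertexL_C_le (lA lB x : ℝ) (hlA0 : 0 < lA) (hlA1 : (3 / 2 : ℝ) * lA ≤ 1) (hlB0 : 0 < lB)
    (hlB1 : (3 / 2 : ℝ) * lB ≤ 1) (hx0 : 0 ≤ x) (hx1 : x ≤ 1) (hBA : lB ≤ lA)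
    (hfeas : (1 - 3 / 2 * lB) * capU lA + (1 - 3 / 2 * lA) * capU lB ≤
        (1 + 1 / 100 - 1 / 7) * (lA + lB - (2 * (3 / 2 : ℝ) - 1) * lA * lB) - (1 + 1 / 100) * lA * lB) :
    (1 - (3 / 2 - 1) * lB) * capU lA * x ^ (Real.log (4 / 3) / Real.log 2) +
          (1 - (3 / 2 - 1) * lA) * capU lB * (1 - x) ^ (Real.log (4 / 3) / Real.log 2) ≤
        (1 - 3 / 2 * lB) * capU lA + (1 - 3 / 2 * lA) * capU lB + (1 + 1 / 100) * lA * lB := by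
  have hA23 : lA ≤ 2 / 3 := by linarith
  have hB23 : lB ≤ 2 / 3 := by linarith
  rcases le_or_gt lA (1 / 2) with hA | hA
  · -- heavy box: the corner is infeasible
    exfalso
    rw [capU_eq_left (show 27 / 7 * lA ≤ 2 by linarith),
      capU_eq_left (show 27 / 7 * lB ≤ 2 by linarith)] at hfeas
    have := mul_pos hlA0 hlB0
    linarith
  · rcases le_or_gt lA (14 / 27) with hA2 | hA2
    · exact SA_C hA.le hA2 hlB0.le hB23 hx0 hx1 hBA hfeas
    · rcases le_or_gt lA (14 / 27 + lB / 7) with hA3 | hA3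
      · obtain ⟨T, hT0, hT1, rfl⟩ : ∃ T : ℝ, 0 ≤ T ∧ T ≤ 1 ∧ lA = 14 / 27 + T * lB / 7 := by
          refine ⟨(lA - 14 / 27) * 7 / lB, div_nonneg (by linarith) hlB0.le, ?_, ?_⟩
          · rw [div_le_one hlB0]; linarith
          · field_simp; ring
        exact W1_C hT0 hT1 hlB0.le hB23 hx0 hx1 hBA hfeas
      · obtain ⟨T, hT0, hT1, rfl⟩ : ∃ T : ℝ, 0 ≤ T ∧ T ≤ 1 ∧
            lA = 14 / 27 + lB / 8 + T * (4 / 27 - lB / 8) := by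
          have hd : 0 < 4 / 27 - lB / 8 := by linarith
          refine ⟨(lA - 14 / 27 - lB / 8) / (4 / 27 - lB / 8), div_nonneg (by linarith) hd.le, ?_, ?_⟩
          · rw [div_le_one hd]; linarith
          · rw [div_mul_cancel₀ _ hd.ne']; ring
        exact W2_C hT0 hT1 hlB0.le hB23 hx0 hx1 hBA hfeas

/-- **The Corner family** for `capU` on the whole light window (by symmetry from `vertexL_C_le`). -/
theorem vertexL_C : ∀ lA lB x : ℝ, 0 < lA → (3 / 2 : ℝ) * lA ≤ 1 → 0 < lB → (3 / 2 : ℝ) * lB ≤ 1 →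
    0 ≤ x → x ≤ 1 →
    (1 - 3 / 2 * lB) * capU lA + (1 - 3 / 2 * lA) * capU lB ≤
        (1 + 1 / 100 - 1 / 7) * (lA + lB - (2 * (3 / 2 : ℝ) - 1) * lA * lB) - (1 + 1 / 100) * lA * lB →
    (1 - (3 / 2 - 1) * lB) * capU lA * x ^ (Real.log (4 / 3) / Real.log 2) +
          (1 - (3 / 2 - 1) * lA) * capU lB * (1 - x) ^ (Real.log (4 / 3) / Real.log 2) ≤
        (1 - 3 / 2 * lB) * capU lA + (1 - 3 / 2 * lA) * capU lB + (1 + 1 / 100) * lA * lB := by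
  intro lA lB x hlA0 hlA1 hlB0 hlB1 hx0 hx1 hfeas
  rcases le_total lB lA with hBA | hAB
  · exact vertexL_C_le lA lB x hlA0 hlA1 hlB0 hlB1 hx0 hx1 hBA hfeas
  · have hfeas' : (1 - 3 / 2 * lA) * capU lB + (1 - 3 / 2 * lB) * capU lA ≤
        (1 + 1 / 100 - 1 / 7) * (lB + lA - (2 * (3 / 2 : ℝ) - 1) * lB * lA) - (1 + 1 / 100) * lB * lA := by linarith
    have h := vertexL_C_le lB lA (1 - x) hlB0 hlB1 hlA0 hlA1 (by linarith) (by linarith) hAB hfeas'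
    have e : 1 - (1 - x) = x := by ring
    rw [e] at h
    linarith

/-! ## The light-base tree cap and the bridge to all schedules -/

/-- **Light-base tree cap at `β = 3/2`.**  Along EVERY admissible product tree of the dial — bases of
any width `b ≥ 0` (share `μ ≤ 2/3`), deviation `≤ R·μ`, size `≥ ℓ_min`, every product node passing the
depth-2 floor `V ≥ 1/7` — `y(T) ≤ R/((1/100)·ℓ_min^{κ_S})·Φ(T)·size(T)^{κ_S}`. -/
theorem tree_cap_light {R ℓmin : ℝ} (hR : 0 ≤ R) (hℓ : 0 < ℓmin) (T : PTree)
    (hT : AdmL (3 / 2) (1 / 7) R ℓmin T) :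
    dev (3 / 2) T ≤ R / (1 / 100 * ℓmin ^ (Real.log (4 / 3) / Real.log 2)) * pot (3 / 2) (1 / 100) T *
      size T ^ (Real.log (4 / 3) / Real.log 2) :=
  tree_cap_light_three_halves hR hℓ vertexL_P1 vertexL_C T hT

/-- **Uniform light-base tree cap**: `y(T) ≤ 58·R/ℓ_min^{κ_S}·size(T)^{κ_S}`. -/
theorem tree_cap_light_uniform {R ℓmin : ℝ} (hR : 0 ≤ R) (hℓ : 0 < ℓmin) (T : PTree)
    (hT : AdmL (3 / 2) (1 / 7) R ℓmin T) :
    dev (3 / 2) T ≤ 58 * R / ℓmin ^ (Real.log (4 / 3) / Real.log 2) * size T ^ (Real.log (4 / 3) / Real.log 2) :=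
  tree_cap_light_three_halves_uniform hR hℓ vertexL_P1 vertexL_C T hT


/-- Every admissible schedule of the floor dial maps to an `AdmL β V_min R (log β)` tree — NO
heavy-base hypothesis: a base `b ≥ 0` has share `1/(b+β) ≤ 1/β`, deviation `y₀ b ≤ R/(b+β)` and size
`log (b+β) ≥ log β`; the depth-2 node floor gives `w ≤ (1 − V_min)·λ` when `β ≤ (1−V_min)(2 − a⁻²)`
(as in kernel XLI-D). -/
theorem toPTree_admL {a β Vmin R : ℝ} (hβ : 1 < β) (ha : 1 ≤ a) (hV0 : 0 ≤ Vmin)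
    (hfloor : β ≤ (1 - Vmin) * (2 - a⁻¹ ^ 2)) (hR : 0 ≤ R) {y₀ : ℝ → ℝ}
    (hy : ∀ b : ℝ, 0 ≤ b → 0 ≤ y₀ b ∧ y₀ b ≤ R / (b + β)) :
    ∀ s : Sched, Sched.Admissible a β s → AdmL β Vmin R (Real.log β) (toPTree β y₀ s)
  | Sched.base b, h => by
      have hb : 0 ≤ b := h.1
      have hbβ : 0 < b + β := by linarith
      obtain ⟨hy0, hy1⟩ := hy b hb
      show 0 < 1 / (b + β) ∧ β * (1 / (b + β)) ≤ 1 ∧ 0 ≤ y₀ b ∧ y₀ b ≤ R * (1 / (b + β)) ∧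
        Real.log β ≤ Real.log (b + β)
      refine ⟨by positivity, ?_, hy0, by rw [mul_one_div]; exact hy1, ?_⟩
      · rw [mul_one_div, div_le_one hbβ]; linarith
      · exact Real.log_le_log (by linarith) (by linarith)
  | Sched.node s t, h => by
      refine ⟨toPTree_admL hβ ha hV0 hfloor hR hy s h.1, toPTree_admL hβ ha hV0 hfloor hR hy t h.2.1, ?_⟩
      -- the depth-2 node floor (verbatim from kernel XLI-D `toPTree_adm`)
      have hfl := h.2.2 2 (by norm_num)
      have hr := r_pos hβ.le (Sched.node s t) h
      obtain ⟨_, hL⟩ := anchor_nonneg_legMass_pos hβ.le (Sched.node s t) h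
      show PTree.wide β (toPTree β y₀ (Sched.node s t)) ≤
        (1 - Vmin) * PTree.share β (toPTree β y₀ (Sched.node s t))
      rw [toPTree_wide hβ.le y₀ (Sched.node s t) h, toPTree_share hβ.le y₀ (Sched.node s t) h]
      unfold Sched.share
      rw [← mul_div_assoc, div_le_div_iff_of_pos_right hr]
      have ha2 : a⁻¹ ^ 2 ≤ 1 := by
        have : a⁻¹ ≤ 1 := inv_le_one_of_one_le₀ ha
        have h0 : 0 ≤ a⁻¹ := inv_nonneg.2 (by linarith)
        nlinarith
      have hc : 0 < 2 - a⁻¹ ^ 2 := by linarith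
      set T := Sched.tailMass β (Sched.node s t) 2 with hT
      set L := Sched.legMass β (Sched.node s t) with hLdef
      by_cases hTn : T ≤ 0
      · have : 0 ≤ (1 - Vmin) * L := by
          have h1V : 0 ≤ 1 - Vmin := by nlinarith
          positivity
        linarith
      · push Not at hTn
        have h1 : (2 - a⁻¹ ^ 2) * T ≤ (1 - Vmin) * (2 - a⁻¹ ^ 2) * L := by
          calc (2 - a⁻¹ ^ 2) * T ≤ β * L := hfl
            _ ≤ (1 - Vmin) * (2 - a⁻¹ ^ 2) * L := mul_le_mul_of_nonneg_right hfloor hL.le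
        have h2 : (2 - a⁻¹ ^ 2) * T ≤ (2 - a⁻¹ ^ 2) * ((1 - Vmin) * L) := by linarith
        exact le_of_mul_le_mul_left h2 hc

/-- **ASKS (iii) of critique g20 for the β = 3/2 dial, ALL bases (model level).**  For every width
`a ≥ 2`, every `R ≥ 0` and base deviations `0 ≤ y₀ b ≤ R/(b + 3/2)` (`b ≥ 0` arbitrary — light bases
`b < 1/2` included), along EVERY admissible schedule of kernel XL-D (chains and trees alike):
`dev (3/2) y₀ s ≤ 58·R/(log (3/2))^{κ_S} · (logSize (3/2) s)^{κ_S}`, `κ_S = log₂(4/3)` — the typed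
TREES cap of the far-edge floor dial at `β = 3/2` with no heavy-base restriction: no floor-respecting
schedule amplifies the first-order deviation faster than Schönhage's order `κ_S`. -/
theorem sched_cap_three_halves_all {a R : ℝ} (ha : 2 ≤ a) (hR : 0 ≤ R) {y₀ : ℝ → ℝ}
    (hy : ∀ b : ℝ, 0 ≤ b → 0 ≤ y₀ b ∧ y₀ b ≤ R / (b + 3 / 2)) (s : Sched)
    (hs : Sched.Admissible a (3 / 2) s) :
    Sched.dev (3 / 2) y₀ s ≤
      58 * R / Real.log (3 / 2) ^ (Real.log (4 / 3) / Real.log 2) *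
        Sched.logSize (3 / 2) s ^ (Real.log (4 / 3) / Real.log 2) := by
  have ha2 : a⁻¹ ^ 2 ≤ 1 / 4 := by
    have h1 : a⁻¹ ≤ 1 / 2 := by
      rw [inv_le_comm₀ (by linarith) (by norm_num)]; norm_num; linarith
    have h0 : 0 ≤ a⁻¹ := inv_nonneg.2 (by linarith)
    nlinarith
  have hfloor : (3 / 2 : ℝ) ≤ (1 - 1 / 7) * (2 - a⁻¹ ^ 2) := by linarith
  have hT := toPTree_admL (β := 3 / 2) (Vmin := 1 / 7) (by norm_num) (by linarith) (by norm_num)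
    hfloor hR hy s hs
  have h := tree_cap_light_uniform hR (Real.log_pos (by norm_num)) (toPTree (3 / 2) y₀ s) hT
  rw [toPTree_dev (by norm_num) y₀ s hs, toPTree_size] at h
  exact h


end Summit.MatrixMultiplication.MatrixMultiplication.Theorems.FarEdgeDescentTreeCapLightVertex
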